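import Summits.QuantumFields.YangMills.Theorems.BalabanUVNodesN17AtRecord13
import Literature.MathematicalPhysics.QuantumFieldTheory.Balaban1983to89.Node00.Record13DatumKey

/-!
# BalabanUVNodes ∕ node N17 = NE4 AT THE STAGE-13 KEYS OF RECORD BY NAME — RR-2's canonical datum key `Node00.IsDatumOfRecord₁₃C F N D` (parameter `h.params`),
# the θ-exposed key `Node00.IsRateKey₁₃ F N D w θ`, the regime record classes `Node00.IsRecordOfRecord₁₃COn ∕ CN`, the LEVEL BUNDLES of RR-1's `Node00.U3Objects₁₁`,
# `S_N17` at the tower-keyed home shape over `Stage13Params` WITH `Provisos₁₃`, and the keyed U3 glue ∕ keyed dictionary at the Stage-13 tuples — the literal reading shape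
# `RateReading 2` of the K3‴ skeleton of record (`SpineGivenEndpointR13`, stmt-QuantumFields-19912; `K3Skeleton13.lean` sha16 19d19a948a455ab7, stubs `stub_rates13 ∕ stub_expansion13`)

Cell `pub-ymgap`, HUMAN RULING D-0062, seat `pub-ymgap-dag-n17-c` (R134 fan-out, strategy s2 = BY-NAME KNIT AT THE RECORD), generation 9; companion 21 (§64–§68) of
`BalabanUVNodesN17Knit` … `…N17AtRecord13` (companion 20, p489645).  THEOREMS ONLY (0 `def`); imports companion 20 (N17 at `datumOfRecord₁₃`: `N17_datumOfRecord₁₃_iff_merged ∕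
_of_rates`, `n17At_datumOfRecord₁₃_iff_merged`, `u2Inputs_datumOfRecord₁₃_iff`; hence module 2's `N17At ∕ S_N17 ∕ RateRecordPred ∕ ReadOutAt ∕ RatesAt` and companion 4's
`af0r_beta0OfMerged_of_scaleShiftRate`, `YMDAG.N17.n17At_of_readOutAt`) and node00-def-RR-2's `Node00/Record13DatumKey` (p489352: `IsDatumOfRecord₁₃C` with `.params ∕ .provisos ∕
.eq_datumOfRecord₁₃ ∕ .βfun_eq_betaOfRecord₁₃`, `IsRateKey₁₃` with `.exists_provisos ∕ .gamma_pos ∕ .gamma_le`, `IsRecordOfRecord₁₃COn ∕ CN`); modifies nothing; every cited lemma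
used BY NAME.  Stage-13 twin of companion 15 (p466348, §49–§52) and companion 19 §59 WITH COMPANION 20's TWO ₁₃ DIFFERENCES: the datum's β is `betaOfRecord₁₃ θ =
betaOfRecord₈Tχ F N TcanOfRecord (chiβOfRecord₁₃ θ) θ.toStage8Params` (NOT `betaOfRecord₁₀`; Record13 (μ) «NO ₁₂ ⇒ ₁₃ β-comparison»), so every face displays
`βmTχ(θ) := betaMerged F (mergedTermFamilyMatT F N (TcanOfRecord F N) (chiβOfRecord₁₃ F N θ) θ.εbg) θ.ρ8 θ.bV`; and the split road runs in MERGED currency ((AF-0r) for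
`beta0OfMerged βmTχ θ.v₀` = N15's currency, the merged remainder's rate = N16 ∕ N18's) — no printed split of record of the ₁₃ β exists (`oneLoopSplitOfRecord₁₁` splits the ₁₁∕₁₂ term).

WHY NOW.  (1) plan g66 registered the K3‴ skeleton (2026-08-27T03:14Z) whose `RateReading 2 := (F : T4Family) → (θ : Stage13Params F 2) → θ.Provisos₁₃ F 2 → (ℕ → ℝ) →
List (ULoop F) → RateCarriers 2` and `KeyedRates rr := ∀ F θ hP, θ.Admissible F 2 → ∀ g₀ os, RatesAt (datumOfRecord₁₃ F 2 θ hP) (rr F θ hP g₀ os)` carry N17 as the conjunct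
`N17At (datumOfRecord₁₃ F 2 θ hP) (rr F θ hP g₀ os).u3`; §66∕§67 are written at THAT shape (`N`-generic; the skeleton instantiates `N = 2` by `exact`): `keyedN17₁₃_iff_merged_of_window`
says what the conjunct IS under `KeyedWindow rr`, `keyedRates₁₃_of_five_glueN17` that it is GLUE (given the other five keyed rates + the keyed (D4) read-out at the same reading,
`KeyedRates rr` holds, N17 supplied by `YMDAG.N17.n17At_of_readOutAt`).  (2) dag-lead DEDUP l.15764 («n17-c pre-stage [the (T-RATE) ₁₃ rate layer] against a local stand-in»): the
₁₃ twin of companions 16∕19 at `RRec₁₃ 𝔯 ∕ RRec₁₃On 𝔯 Rg` (companion 22, pre-staged) imports THIS file for its key faces, as companion 16 imports companion 15.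
§64 AT `IsDatumOfRecord₁₃C` · §65 AT `IsRateKey₁₃` · §66 LEVEL BUNDLES + HOME SHAPES over `rc : F → θ → θ.Provisos₁₃ F N → g₀ → os → ℕ → RateCarriers N` (layer B's tower shape at ₁₃;
`rc` a PARAMETER) · §67 KEYED GLUE ∕ DICTIONARY at `rr F θ hP g₀ os`, GUARD-GENERIC in `P F θ hP` · §68 AT `IsRecordOfRecord₁₃COn ∕ CN` (the estimate asked only IN THE REGIME).
NOT VACUOUS at Stage 13 modulo K0‴ (`Record13Inhabited`, stmt-QuantumFields-19909, open — NOT claimed); every rate input ((AF-0r), the merged remainder's rate, (D4), NE5,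
N14 ∕ N15 ∕ N16 ∕ N22 at the tuples) a displayed HYPOTHESIS; the readings `rc ∕ rr` are PARAMETERS (contentful only when NAMED).

HONEST FRAMING.  Kernel bookkeeping BY NAME; 0 sorry; NE4 NOT IN PRINT ([Balaban1987RG1] (1.20)–(1.22) p. 264) and NOT PROVED; nothing of Bałaban's asserted; the K3‴ stubs are
NEITHER claimed NOR refuted (their N17 conjunct is displayed as glue ∕ as one merged-β sentence, nothing more); N17 = composite (max of N15, N16, (D4)), NOT discharged; counts
UNMOVED (typed 28∕28 · discharged 5∕27, A 5∕28).  One finite four-torus at fixed ε per run — NOT ℝ⁴, NOT infinite volume, NOT OS, NOT a mass gap, NOT Clay.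
-/

noncomputable section

open scoped Matrix.Norms.L2Operator

namespace Summit.QuantumFields.YangMills.Theorems.BalabanUVNodesN17

open Literature.MathematicalPhysics.QuantumFieldTheory.Balaban1983to89
open Literature.MathematicalPhysics.QuantumFieldTheory.Balaban1983to89.FlowStep
open Literature.MathematicalPhysics.QuantumFieldTheory.Balaban1983to89.T4CouplingMatching
open Literature.MathematicalPhysics.QuantumFieldTheory.Balaban1983to89.T4Continuum (T4Family FiniteEpsData ULoop)
open Literature.MathematicalPhysics.QuantumFieldTheory.Balaban1983to89.T4OutputRate (Window)
open Literature.MathematicalPhysics.QuantumFieldTheory.Balaban1983to89.Node00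
open Literature.MathematicalPhysics.QuantumFieldTheory.Balaban1983to89.DagBinding (WorldP)
open Summit.QuantumFields.BalabanUV.T4Continuum.Spine.NE4 (NE4OnData U2Inputs ne4OnData_iff)
open YMDAG.UVSplit (Datum U3Carriers RateCarriers RateRecordPred N17At N14At N15At N16At N18At N22At ReadOutAt RatesAt S_N17)

variable {F : T4Family} {N : ℕ} [NeZero N]

/-! ## §64 N17 AT THE CANONICAL DATUM KEY `IsDatumOfRecord₁₃C F N D` (RR-2): the datum's β IS `betaOfRecord₁₃ h.params` — the `(TcanOfRecord, χβ₁₃)` assembly -/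

/-- **N17 AT A STAGE-13 DATUM OF RECORD IS THE SCALE-SHIFT RATE OF `betaOfRecord₁₃ h.params`** — every box side (`h.βfun_eq_betaOfRecord₁₃`; NOT `betaOfRecord₁₀`:
Record13 re-bases β on the canonical-version transport and the (2.9) species). [cite: Balaban1987RG1, (1.20)-(1.22) p.264 and (2.9) p.266] -/
theorem N17_iff_betaOfRecord₁₃_params₁₃ {D : Datum F N} (h : IsDatumOfRecord₁₃C F N D) (c ρ γ' : ℝ) :
    NE4OnData D c ρ γ' ↔ ScaleShiftRate c ρ γ' (betaOfRecord₁₃ F N h.params) := by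
  rw [ne4OnData_iff, h.βfun_eq_betaOfRecord₁₃]

/-- **… AND, ON BOXES INSIDE THE CANONICAL RECORD BOX (`γ' ≤ h.params.γ`), OF THE CANONICAL-VERSION MERGED β `βmTχ(h.params)` AT THE (2.9) SPECIES** (companion 20
`N17_datumOfRecord₁₃_iff_merged` at the canonical presentation `D = datumOfRecord₁₃ F N h.params h.provisos`). [cite: Balaban1987RG1, (1.22) p.264 and (2.12)-(2.14) p.268] -/
theorem N17_iff_merged_params₁₃ {D : Datum F N} (h : IsDatumOfRecord₁₃C F N D) {c ρ γ' : ℝ} (hγ : γ' ≤ h.params.γ) :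
    NE4OnData D c ρ γ' ↔
      letI := h.params.instVβ₁; letI := h.params.instVβ₂; letI := h.params.instιβ
      ScaleShiftRate c ρ γ'
        (betaMerged F (mergedTermFamilyMatT F N (TcanOfRecord F N) (chiβOfRecord₁₃ F N h.params) h.params.εbg) h.params.ρ8 h.params.bV) := by
  have key := N17_datumOfRecord₁₃_iff_merged (c := c) (ρ := ρ) h.params h.provisos hγ
  rwa [← h.eq_datumOfRecord₁₃] at key

/-- **… IN CLUSTER K4's LETTERS**: for node U3's carriers `u` with `u.γ ≤ h.params.γ`, `N17At D u ↔` the `βmTχ(h.params)` rate at `(u.cr·u.C₅·u.θ, u.ρ, u.γ)`.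
[cite: Balaban1987RG1, (1.20)-(1.22) p.264] -/
theorem n17At_iff_params₁₃ {D : Datum F N} (h : IsDatumOfRecord₁₃C F N D) (u : U3Carriers) (hγ : u.γ ≤ h.params.γ) :
    N17At D u ↔
      letI := h.params.instVβ₁; letI := h.params.instVβ₂; letI := h.params.instιβ
      ScaleShiftRate (u.cr * u.C₅ * u.θ) u.ρ u.γ
        (betaMerged F (mergedTermFamilyMatT F N (TcanOfRecord F N) (chiβOfRecord₁₃ F N h.params) h.params.εbg) h.params.ρ8 h.params.bV) :=
  N17_iff_merged_params₁₃ h hγ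

/-- K4's letters, every box side: `N17At D u ↔ ScaleShiftRate (u.cr·u.C₅·u.θ) u.ρ u.γ (betaOfRecord₁₃ h.params)`. [cite: Balaban1987RG1, (1.20)-(1.22) p.264] -/
theorem n17At_iff_betaOfRecord₁₃_params₁₃ {D : Datum F N} (h : IsDatumOfRecord₁₃C F N D) (u : U3Carriers) :
    N17At D u ↔ ScaleShiftRate (u.cr * u.C₅ * u.θ) u.ρ u.γ (betaOfRecord₁₃ F N h.params) :=
  N17_iff_betaOfRecord₁₃_params₁₃ h _ _ _

/-- **NODE U2's INPUT TRIPLE AT A STAGE-13 DATUM OF RECORD** (box `γ' ≤ h.params.γ`): the `βmTχ(h.params)` rate ∧ its history moduli ∧ fading memory (companion 20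
`u2Inputs_datumOfRecord₁₃_iff` at the canonical presentation). [cite: Balaban1987RG1, §5 p.298] -/
theorem u2Inputs_iff_params₁₃ {D : Datum F N} (h : IsDatumOfRecord₁₃C F N D) {c C ρ γ' : ℝ} {Λ : ℕ → ℕ → ℝ} (hγ : γ' ≤ h.params.γ) :
    U2Inputs D c C ρ γ' Λ ↔
      letI := h.params.instVβ₁; letI := h.params.instVβ₂; letI := h.params.instιβ
      ScaleShiftRate c ρ γ'
          (betaMerged F (mergedTermFamilyMatT F N (TcanOfRecord F N) (chiβOfRecord₁₃ F N h.params) h.params.εbg) h.params.ρ8 h.params.bV) ∧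
        HistLipschitz Λ γ'
          (betaMerged F (mergedTermFamilyMatT F N (TcanOfRecord F N) (chiβOfRecord₁₃ F N h.params) h.params.εbg) h.params.ρ8 h.params.bV) ∧
        FadingMemory C ρ Λ := by
  have key := u2Inputs_datumOfRecord₁₃_iff (c := c) (C := C) (ρ := ρ) (Λ := Λ) h.params h.provisos hγ
  rwa [← h.eq_datumOfRecord₁₃] at key

/-- **THE SPLIT ROAD AT A STAGE-13 DATUM OF RECORD, IN MERGED CURRENCY** (companion 20 `N17_datumOfRecord₁₃_of_rates` at the canonical presentation; no printed split of record of the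
₁₃ β exists): (AF-0r) for `beta0OfMerged βmTχ(h.params) h.params.v₀` (N15's currency) ∧ `ScaleShiftRate c₁ ρ γ' (βmTχ − β⁰)` (N16 ∕ N18's), `γ' ≤ h.params.γ`, `0 ≤ ρ ≤ 1`, `0 ≤ c₀`
⟹ `NE4OnData D (2c₀ + c₁) ρ γ'`.  Both binders UNPRINTED, displayed. [cite: Balaban1987RG1, (2.12)-(2.14) p.268] -/
theorem N17_params₁₃_of_rates {D : Datum F N} (h : IsDatumOfRecord₁₃C F N D) {binf c₀ c₁ ρ γ' : ℝ} (hγ : γ' ≤ h.params.γ) (hρ0 : 0 ≤ ρ) (hρ1 : ρ ≤ 1)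
    (hc₀ : 0 ≤ c₀)
    (hconv : letI := h.params.instVβ₁; letI := h.params.instVβ₂; letI := h.params.instιβ
      ∀ k, |beta0OfMerged (betaMerged F (mergedTermFamilyMatT F N (TcanOfRecord F N) (chiβOfRecord₁₃ F N h.params) h.params.εbg) h.params.ρ8 h.params.bV)
        h.params.v₀ k - binf| ≤ c₀ * ρ ^ k)
    (hrem : letI := h.params.instVβ₁; letI := h.params.instVβ₂; letI := h.params.instιβ
      ScaleShiftRate c₁ ρ γ' fun k w =>
        betaMerged F (mergedTermFamilyMatT F N (TcanOfRecord F N) (chiβOfRecord₁₃ F N h.params) h.params.εbg) h.params.ρ8 h.params.bV k w -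
          beta0OfMerged (betaMerged F (mergedTermFamilyMatT F N (TcanOfRecord F N) (chiβOfRecord₁₃ F N h.params) h.params.εbg) h.params.ρ8 h.params.bV)
            h.params.v₀ k) :
    NE4OnData D (2 * c₀ + c₁) ρ γ' := by
  have key := N17_datumOfRecord₁₃_of_rates h.params h.provisos hγ hρ0 hρ1 hc₀ hconv hrem
  rwa [← h.eq_datumOfRecord₁₃] at key

/-- **WHAT N17 DELIVERS AT A STAGE-13 DATUM OF RECORD**: on `0 < γ' ≤ h.params.γ` with `ρ < 1`, `Beta0LimitExists βmTχ(h.params) h.params.v₀` at COHERENT reference histories with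
entries in `]0,γ']`, `NE4OnData D c ρ γ'` ⟹ (AF-0r) `∃ β⁰_∞, |beta0OfMerged βmTχ(h.params) h.params.v₀ k − β⁰_∞| ≤ (c∕(1−ρ))ρ^k` (companion 4). [cite: Balaban1987RG1, (2.12)-(2.14) p.268] -/
theorem af0r_params₁₃_of_N17 {D : Datum F N} (h : IsDatumOfRecord₁₃C F N D) {c ρ γ' : ℝ} (hγ : γ' ≤ h.params.γ) (hγ' : 0 < γ') (hρ1 : ρ < 1)
    (hlim : letI := h.params.instVβ₁; letI := h.params.instVβ₂; letI := h.params.instιβ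
      Beta0LimitExists (betaMerged F (mergedTermFamilyMatT F N (TcanOfRecord F N) (chiβOfRecord₁₃ F N h.params) h.params.εbg) h.params.ρ8 h.params.bV)
        h.params.v₀)
    (hcoh : ∀ k, Fin.tail (h.params.v₀ (k + 1)) = h.params.v₀ k) (hadm : ∀ k i, 0 < h.params.v₀ k i ∧ h.params.v₀ k i ≤ γ')
    (hN17 : NE4OnData D c ρ γ') :
    letI := h.params.instVβ₁; letI := h.params.instVβ₂; letI := h.params.instιβ
    ∃ binf : ℝ, ∀ k,
      |beta0OfMerged (betaMerged F (mergedTermFamilyMatT F N (TcanOfRecord F N) (chiβOfRecord₁₃ F N h.params) h.params.εbg) h.params.ρ8 h.params.bV)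
          h.params.v₀ k - binf| ≤ c / (1 - ρ) * ρ ^ k := by
  letI := h.params.instVβ₁; letI := h.params.instVβ₂; letI := h.params.instιβ
  exact af0r_beta0OfMerged_of_scaleShiftRate hlim hcoh hadm hγ' hρ1 ((N17_iff_merged_params₁₃ h hγ).mp hN17)

/-! ## §65 N17 AT THE θ-EXPOSED WORLD-BOUND KEY `IsRateKey₁₃ F N D w θ` (RR-2 §3): an `iff` about THAT θ -/

/-- **N17 AT A KEYED STAGE-13 RECORD, ON THE WORLD's WINDOW, IS THE SCALE-SHIFT RATE OF THE KEY's MERGED β `βmTχ(θ)`** (the key realises `D = datumOfRecord₁₃ θ hP` with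
`w.γ ≤ θ.γ`; companion 20 `N17_datumOfRecord₁₃_iff_merged`). [cite: Balaban1987RG1, (1.20)-(1.22) p.264; Balaban1989LargeFieldII, Thm 1 p.355] -/
theorem N17_iff_of_isRateKey₁₃ {D : Datum F N} {w : WorldP} {θ : Stage13Params F N} (hk : IsRateKey₁₃ F N D w θ) (c ρ : ℝ) :
    NE4OnData D c ρ w.γ ↔
      letI := θ.instVβ₁; letI := θ.instVβ₂; letI := θ.instιβ
      ScaleShiftRate c ρ w.γ (betaMerged F (mergedTermFamilyMatT F N (TcanOfRecord F N) (chiβOfRecord₁₃ F N θ) θ.εbg) θ.ρ8 θ.bV) := by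
  obtain ⟨hP, -, hD⟩ := hk.exists_provisos
  have hγ := hk.gamma_le
  subst hD
  exact N17_datumOfRecord₁₃_iff_merged θ hP hγ

/-- … on ANY box inside the key's record box (`γ' ≤ θ.γ`). [cite: Balaban1987RG1, (1.20)-(1.22) p.264] -/
theorem N17_iff_of_isRateKey₁₃_of_le {D : Datum F N} {w : WorldP} {θ : Stage13Params F N} (hk : IsRateKey₁₃ F N D w θ) {c ρ γ' : ℝ}
    (hγ : γ' ≤ θ.γ) :
    NE4OnData D c ρ γ' ↔
      letI := θ.instVβ₁; letI := θ.instVβ₂; letI := θ.instιβ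
      ScaleShiftRate c ρ γ' (betaMerged F (mergedTermFamilyMatT F N (TcanOfRecord F N) (chiβOfRecord₁₃ F N θ) θ.εbg) θ.ρ8 θ.bV) := by
  obtain ⟨hP, -, hD⟩ := hk.exists_provisos
  subst hD
  exact N17_datumOfRecord₁₃_iff_merged θ hP hγ

/-- … in K4's letters, for node U3's carriers with `u.γ ≤ θ.γ`. [cite: Balaban1987RG1, (1.20)-(1.22) p.264] -/
theorem n17At_iff_of_isRateKey₁₃ {D : Datum F N} {w : WorldP} {θ : Stage13Params F N} (hk : IsRateKey₁₃ F N D w θ) (u : U3Carriers)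
    (hγ : u.γ ≤ θ.γ) :
    N17At D u ↔
      letI := θ.instVβ₁; letI := θ.instVβ₂; letI := θ.instιβ
      ScaleShiftRate (u.cr * u.C₅ * u.θ) u.ρ u.γ (betaMerged F (mergedTermFamilyMatT F N (TcanOfRecord F N) (chiβOfRecord₁₃ F N θ) θ.εbg) θ.ρ8 θ.bV) :=
  N17_iff_of_isRateKey₁₃_of_le hk hγ

/-! ## §66 N17 AT THE LEVEL BUNDLES OF RR-1's `U3Objects₁₁` AT THE STAGE-13 KEY, AND THE HOME SHAPES OVER A READING TAKING THE ₁₃ PROVISOS -/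

/-- **N17 AT THE LEVEL-`k` BUNDLE OF THE RECORD's U3 OBJECTS AT A STAGE-13 DATUM OF RECORD**, window inside the canonical record box (`γ ≤ h.params.γ`; layer B takes
`γ := h.params.γ`): ⟺ the `βmTχ(h.params)` rate `ScaleShiftRate (u.cr·u.C₅·u.θ₅) u.ρ γ` — level-free and carrier-free. [cite: Balaban1987RG1, (1.20)-(1.22) p.264] -/
theorem n17At_u3Level_iff_params₁₃ {D : Datum F N} (h : IsDatumOfRecord₁₃C F N D) (u : U3Objects₁₁) {γ : ℝ} (hγ : γ ≤ h.params.γ) (k : ℕ) :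
    N17At D ⟨u.levelCarriers k, Window γ, γ, u.κ, u.EA k, u.EB k, u.θ₅, u.C₅, u.moduli, u.C₉, u.ω, u.cr, u.ρ⟩ ↔
      letI := h.params.instVβ₁; letI := h.params.instVβ₂; letI := h.params.instιβ
      ScaleShiftRate (u.cr * u.C₅ * u.θ₅) u.ρ γ
        (betaMerged F (mergedTermFamilyMatT F N (TcanOfRecord F N) (chiβOfRecord₁₃ F N h.params) h.params.εbg) h.params.ρ8 h.params.bV) :=
  N17_iff_merged_params₁₃ h hγ

section HomeShapes

variable (rc : (F : T4Family) → (θ : Stage13Params F N) → θ.Provisos₁₃ F N → (ℕ → ℝ) → List (ULoop F) → ℕ → RateCarriers N)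

/-- **`S_N17` AT A TOWER-KEYED RATE RECORD OF LAYER B's LITERAL STAGE-13 SHAPE** «`RRec F D g₀ os R :↔ ∃ (h : IsDatumOfRecord₁₃C F N D) (k : ℕ), R = rc F h.params h.provisos g₀ os k`»
(the (T-RATE) `RRec₁₃ 𝔯` is this with `rc := rateCarriersOfRecord₁₃ 𝔯`; the reading TAKES THE ₁₃ PROVISOS) ⟺ at every Stage-13 datum of record, every `g₀, os, k`: the scale-shift
rate of `betaOfRecord₁₃ h.params` at the reading's U3 letters — every box side; `rc` a PARAMETER. [cite: Balaban1987RG1, (1.20)-(1.22) p.264] -/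
theorem s_N17_towerKeyed₁₃_iff :
    S_N17 (fun F (D : Datum F N) g₀ os R => ∃ (h : IsDatumOfRecord₁₃C F N D) (k : ℕ), R = rc F h.params h.provisos g₀ os k) ↔
      ∀ (F : T4Family) (D : Datum F N) (h : IsDatumOfRecord₁₃C F N D) (g₀ : ℕ → ℝ) (os : List (ULoop F)) (k : ℕ),
        ScaleShiftRate
          ((rc F h.params h.provisos g₀ os k).u3.cr * (rc F h.params h.provisos g₀ os k).u3.C₅ * (rc F h.params h.provisos g₀ os k).u3.θ)
          (rc F h.params h.provisos g₀ os k).u3.ρ (rc F h.params h.provisos g₀ os k).u3.γ (betaOfRecord₁₃ F N h.params) := by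
  constructor
  · intro hS F D h g₀ os k
    exact (n17At_iff_betaOfRecord₁₃_params₁₃ h _).mp (hS F D g₀ os _ ⟨h, k, rfl⟩)
  · rintro hin F D g₀ os R ⟨h, k, rfl⟩
    exact (n17At_iff_betaOfRecord₁₃_params₁₃ h _).mpr (hin F D h g₀ os k)

/-- **… FROM THE MERGED-β RATE** when the reading's window sits inside the canonical record box (`(rc …).u3.γ ≤ h.params.γ`, e.g. layer B's `u3.γ = θ.γ`): the
`βmTχ(h.params)` rate at the letters, for every datum key, `g₀, os, k` ⟹ `S_N17` there. [cite: Balaban1987RG1, (1.20)-(1.22) p.264] -/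
theorem s_N17_towerKeyed₁₃_of_merged
    (hin : ∀ (F : T4Family) (D : Datum F N) (h : IsDatumOfRecord₁₃C F N D) (g₀ : ℕ → ℝ) (os : List (ULoop F)) (k : ℕ),
      (rc F h.params h.provisos g₀ os k).u3.γ ≤ h.params.γ ∧
        letI := h.params.instVβ₁; letI := h.params.instVβ₂; letI := h.params.instιβ
        ScaleShiftRate
          ((rc F h.params h.provisos g₀ os k).u3.cr * (rc F h.params h.provisos g₀ os k).u3.C₅ * (rc F h.params h.provisos g₀ os k).u3.θ)
          (rc F h.params h.provisos g₀ os k).u3.ρ (rc F h.params h.provisos g₀ os k).u3.γ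
          (betaMerged F (mergedTermFamilyMatT F N (TcanOfRecord F N) (chiβOfRecord₁₃ F N h.params) h.params.εbg) h.params.ρ8 h.params.bV)) :
    S_N17 (fun F (D : Datum F N) g₀ os R => ∃ (h : IsDatumOfRecord₁₃C F N D) (k : ℕ), R = rc F h.params h.provisos g₀ os k) := by
  rintro F D g₀ os R ⟨h, k, rfl⟩
  obtain ⟨hγ, hm⟩ := hin F D h g₀ os k
  exact (n17At_iff_params₁₃ h _ hγ).mpr hm

end HomeShapes

/-- **(W2) CLOSER FOR ANY `RRec` WHOSE BUNDLES COME WITH A STAGE-13 DATUM KEY** (refinement-generic): every bundle `R` of record comes with `h : IsDatumOfRecord₁₃C F N D`,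
`R.u3.γ ≤ h.params.γ` and the `βmTχ(h.params)` rate at `R.u3`'s letters ⟹ `S_N17 RRec` (ONE application at the (T-RATE) ₁₃ home). [cite: Balaban1987RG1, (1.20)-(1.22) p.264] -/
theorem s_N17_of_datumKeyed₁₃ (RRec : RateRecordPred N)
    (hkey : ∀ (F : T4Family) (D : Datum F N) (g₀ : ℕ → ℝ) (os : List (ULoop F)) (R : RateCarriers N), RRec F D g₀ os R →
      ∃ h : IsDatumOfRecord₁₃C F N D, R.u3.γ ≤ h.params.γ ∧
        letI := h.params.instVβ₁; letI := h.params.instVβ₂; letI := h.params.instιβ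
        ScaleShiftRate (R.u3.cr * R.u3.C₅ * R.u3.θ) R.u3.ρ R.u3.γ
          (betaMerged F (mergedTermFamilyMatT F N (TcanOfRecord F N) (chiβOfRecord₁₃ F N h.params) h.params.εbg) h.params.ρ8 h.params.bV)) :
    S_N17 RRec := by
  intro F D g₀ os R hR
  obtain ⟨h, hγ, hm⟩ := hkey F D g₀ os R hR
  exact (n17At_iff_params₁₃ h R.u3 hγ).mpr hm

/-- **(W2) CLOSER FOR ANY `RRec` WHOSE BUNDLES COME WITH A θ-EXPOSED STAGE-13 KEY** whose world window IS node U3's box (`R.u3.γ = w.γ`) and the `βmTχ(θ)` rate at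
`R.u3`'s letters ⟹ `S_N17 RRec` (RR-2 §3's world-bound road; companion 20 `s_N17_of_rec₁₃C` without the ∀ θ). [cite: Balaban1987RG1, (1.20)-(1.22) p.264] -/
theorem s_N17_of_rateKeyed₁₃ (RRec : RateRecordPred N)
    (hkey : ∀ (F : T4Family) (D : Datum F N) (g₀ : ℕ → ℝ) (os : List (ULoop F)) (R : RateCarriers N), RRec F D g₀ os R →
      ∃ (θ : Stage13Params F N) (w : WorldP), IsRateKey₁₃ F N D w θ ∧ R.u3.γ = w.γ ∧
        letI := θ.instVβ₁; letI := θ.instVβ₂; letI := θ.instιβ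
        ScaleShiftRate (R.u3.cr * R.u3.C₅ * R.u3.θ) R.u3.ρ R.u3.γ
          (betaMerged F (mergedTermFamilyMatT F N (TcanOfRecord F N) (chiβOfRecord₁₃ F N θ) θ.εbg) θ.ρ8 θ.bV)) :
    S_N17 RRec := by
  intro F D g₀ os R hR
  obtain ⟨θ, w, hk, hγ, hm⟩ := hkey F D g₀ os R hR
  exact (n17At_iff_of_isRateKey₁₃ hk R.u3 (hγ.le.trans hk.gamma_le)).mpr hm

/-! ## §67 THE KEYED U3 GLUE «(D4) ∧ NE5 ⇒ NE4» AND THE KEYED DICTIONARY AT THE STAGE-13 TUPLES — K3‴'s reading shape `rr F θ hP g₀ os`, GUARD-GENERIC -/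

section KeyedGlue

variable (P : (F : T4Family) → (θ : Stage13Params F N) → θ.Provisos₁₃ F N → Prop)
variable (rr : (F : T4Family) → (θ : Stage13Params F N) → θ.Provisos₁₃ F N → (ℕ → ℝ) → List (ULoop F) → RateCarriers N)

/-- **THE KEYED N17 STUB FROM THE KEYED (D4) AND NE5 STUBS, Stage 13, FOR ANY GUARD `P` ON THE TUPLE** (`P F θ hP := θ.Admissible F N` is K3‴'s `KeyedRates` guard; the guard of
record `θ.ZtUnity ∧ θ.SlotsNondegenerate₁₃ ∧ θ.Admissible` or any prefix implying it; the glue never reads `P`): the (D4) read-out binders at `(datumOfRecord₁₃ θ hP, (rr F θ hP g₀ os).u3)` and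
NE5 at `(rr F θ hP g₀ os).u3` under the guard ⟹ the keyed N17 stub — pointwise `YMDAG.N17.n17At_of_readOutAt` (the U3 → U2 edge, N22 idle).  (D4) and NE5 UNPRINTED — binders.
[cite: Balaban1987RG1, (1.20)-(1.22) p.264] -/
theorem n17_keyed₁₃_of_readOut_keyed
    (hD4 : ∀ (F : T4Family) (θ : Stage13Params F N) (hP : θ.Provisos₁₃ F N), P F θ hP → ∀ (g₀ : ℕ → ℝ) (os : List (ULoop F)),
      ReadOutAt (datumOfRecord₁₃ F N θ hP) (rr F θ hP g₀ os).u3)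
    (h18 : ∀ (F : T4Family) (θ : Stage13Params F N) (hP : θ.Provisos₁₃ F N), P F θ hP → ∀ (g₀ : ℕ → ℝ) (os : List (ULoop F)),
      N18At (rr F θ hP g₀ os).u3)
    (F : T4Family) (θ : Stage13Params F N) (hP : θ.Provisos₁₃ F N) (hθ : P F θ hP) (g₀ : ℕ → ℝ) (os : List (ULoop F)) :
    N17At (datumOfRecord₁₃ F N θ hP) (rr F θ hP g₀ os).u3 :=
  YMDAG.N17.n17At_of_readOutAt _ (hD4 F θ hP hθ g₀ os) (h18 F θ hP hθ g₀ os)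

/-- **`RatesAt` AT THE KEYED READING FROM THE FIVE KEYED RATE STUBS AND THE KEYED (D4), Stage 13, any guard `P`** (N17 GLUED, not assumed): N14 NE1′ · N15 NE2 · N16 NE3 ·
N18 NE5 · N22 NE9 at `rr F θ hP g₀ os` and the (D4) read-out on the datum of record, under the guard ⟹ `RatesAt (datumOfRecord₁₃ θ hP) (rr F θ hP g₀ os)` under the same
guard. [bookkeeping] [cite: Balaban1987RG1, (1.20)-(1.22) p.264] -/
theorem ratesAt_keyed₁₃_of_five_glueN17
    (h14 : ∀ (F : T4Family) (θ : Stage13Params F N) (hP : θ.Provisos₁₃ F N), P F θ hP → ∀ (g₀ : ℕ → ℝ) (os : List (ULoop F)),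
      N14At (rr F θ hP g₀ os).ne1)
    (h15 : ∀ (F : T4Family) (θ : Stage13Params F N) (hP : θ.Provisos₁₃ F N), P F θ hP → ∀ (g₀ : ℕ → ℝ) (os : List (ULoop F)),
      N15At (rr F θ hP g₀ os).ne2)
    (h16 : ∀ (F : T4Family) (θ : Stage13Params F N) (hP : θ.Provisos₁₃ F N), P F θ hP → ∀ (g₀ : ℕ → ℝ) (os : List (ULoop F)),
      N16At (rr F θ hP g₀ os).ne3)
    (h18 : ∀ (F : T4Family) (θ : Stage13Params F N) (hP : θ.Provisos₁₃ F N), P F θ hP → ∀ (g₀ : ℕ → ℝ) (os : List (ULoop F)),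
      N18At (rr F θ hP g₀ os).u3)
    (h22 : ∀ (F : T4Family) (θ : Stage13Params F N) (hP : θ.Provisos₁₃ F N), P F θ hP → ∀ (g₀ : ℕ → ℝ) (os : List (ULoop F)),
      N22At (rr F θ hP g₀ os).u3)
    (hD4 : ∀ (F : T4Family) (θ : Stage13Params F N) (hP : θ.Provisos₁₃ F N), P F θ hP → ∀ (g₀ : ℕ → ℝ) (os : List (ULoop F)),
      ReadOutAt (datumOfRecord₁₃ F N θ hP) (rr F θ hP g₀ os).u3)
    (F : T4Family) (θ : Stage13Params F N) (hP : θ.Provisos₁₃ F N) (hθ : P F θ hP) (g₀ : ℕ → ℝ) (os : List (ULoop F)) :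
    RatesAt (datumOfRecord₁₃ F N θ hP) (rr F θ hP g₀ os) :=
  ⟨h14 F θ hP hθ g₀ os, h15 F θ hP hθ g₀ os, h16 F θ hP hθ g₀ os, n17_keyed₁₃_of_readOut_keyed P rr hD4 h18 F θ hP hθ g₀ os,
    h18 F θ hP hθ g₀ os, h22 F θ hP hθ g₀ os⟩

/-- **K3‴'s `KeyedRates rr` LITERALLY (guard `θ.Admissible F N`), WITH ITS N17 CONJUNCT GLUED**: the five keyed rates N14 ∕ N15 ∕ N16 ∕ N18 ∕ N22 and the keyed (D4) read-out at a
reading `rr` of the skeleton's shape ⟹ the text of `K3Skeleton13.KeyedRates rr` unfolded (`N`-generic; `N = 2` by `exact`): a `stub_rates13` prover owes N17 NOTHING beyond (D4) and NE5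
at its own reading; `KeyedWindow rr` not needed.  All six inputs UNPRINTED — binders. [bookkeeping] [cite: Balaban1987RG1, (1.20)-(1.22) p.264] -/
theorem keyedRates₁₃_of_five_glueN17
    (h14 : ∀ (F : T4Family) (θ : Stage13Params F N) (hP : θ.Provisos₁₃ F N), θ.Admissible F N → ∀ (g₀ : ℕ → ℝ) (os : List (ULoop F)),
      N14At (rr F θ hP g₀ os).ne1)
    (h15 : ∀ (F : T4Family) (θ : Stage13Params F N) (hP : θ.Provisos₁₃ F N), θ.Admissible F N → ∀ (g₀ : ℕ → ℝ) (os : List (ULoop F)),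
      N15At (rr F θ hP g₀ os).ne2)
    (h16 : ∀ (F : T4Family) (θ : Stage13Params F N) (hP : θ.Provisos₁₃ F N), θ.Admissible F N → ∀ (g₀ : ℕ → ℝ) (os : List (ULoop F)),
      N16At (rr F θ hP g₀ os).ne3)
    (h18 : ∀ (F : T4Family) (θ : Stage13Params F N) (hP : θ.Provisos₁₃ F N), θ.Admissible F N → ∀ (g₀ : ℕ → ℝ) (os : List (ULoop F)),
      N18At (rr F θ hP g₀ os).u3)
    (h22 : ∀ (F : T4Family) (θ : Stage13Params F N) (hP : θ.Provisos₁₃ F N), θ.Admissible F N → ∀ (g₀ : ℕ → ℝ) (os : List (ULoop F)),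
      N22At (rr F θ hP g₀ os).u3)
    (hD4 : ∀ (F : T4Family) (θ : Stage13Params F N) (hP : θ.Provisos₁₃ F N), θ.Admissible F N → ∀ (g₀ : ℕ → ℝ) (os : List (ULoop F)),
      ReadOutAt (datumOfRecord₁₃ F N θ hP) (rr F θ hP g₀ os).u3) :
    ∀ (F : T4Family) (θ : Stage13Params F N) (hP : θ.Provisos₁₃ F N), θ.Admissible F N → ∀ (g₀ : ℕ → ℝ) (os : List (ULoop F)),
      RatesAt (datumOfRecord₁₃ F N θ hP) (rr F θ hP g₀ os) :=
  ratesAt_keyed₁₃_of_five_glueN17 (fun F θ _ => θ.Admissible F N) rr h14 h15 h16 h18 h22 hD4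

/-- **THE KEYED DICTIONARY — WHAT THE N17 CONJUNCT OF K3‴'s `KeyedRates rr` IS, UNDER `KeyedWindow rr`** (`(rr F θ hP g₀ os).u3.γ = θ.γ`), any guard `P`: the keyed N17 stub ⟺
«for every tuple with provisos under the guard, every `g₀, os`: `ScaleShiftRate (u.cr·u.C₅·u.θ) u.ρ θ.γ βmTχ(θ)` at `u := (rr F θ hP g₀ os).u3`» (companion 20
`n17At_datumOfRecord₁₃_iff_merged`) — the ONE sentence an estimate seat proves for N17 at a keyed ₁₃ reading.  NE4 NOT IN PRINT. [cite: Balaban1987RG1, (1.20)-(1.22) p.264] -/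
theorem keyedN17₁₃_iff_merged_of_window
    (hw : ∀ (F : T4Family) (θ : Stage13Params F N) (hP : θ.Provisos₁₃ F N) (g₀ : ℕ → ℝ) (os : List (ULoop F)), (rr F θ hP g₀ os).u3.γ = θ.γ) :
    (∀ (F : T4Family) (θ : Stage13Params F N) (hP : θ.Provisos₁₃ F N), P F θ hP → ∀ (g₀ : ℕ → ℝ) (os : List (ULoop F)),
        N17At (datumOfRecord₁₃ F N θ hP) (rr F θ hP g₀ os).u3) ↔
      ∀ (F : T4Family) (θ : Stage13Params F N) (hP : θ.Provisos₁₃ F N), P F θ hP → ∀ (g₀ : ℕ → ℝ) (os : List (ULoop F)),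
        letI := θ.instVβ₁; letI := θ.instVβ₂; letI := θ.instιβ
        ScaleShiftRate ((rr F θ hP g₀ os).u3.cr * (rr F θ hP g₀ os).u3.C₅ * (rr F θ hP g₀ os).u3.θ) (rr F θ hP g₀ os).u3.ρ θ.γ
          (betaMerged F (mergedTermFamilyMatT F N (TcanOfRecord F N) (chiβOfRecord₁₃ F N θ) θ.εbg) θ.ρ8 θ.bV) := by
  refine forall₅_congr fun F θ hP _ g₀ => forall_congr' fun os => ?_
  rw [← hw F θ hP g₀ os]
  exact n17At_datumOfRecord₁₃_iff_merged θ hP _ (hw F θ hP g₀ os).le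

/-- **THE ONE-APPLICATION CLOSER OF THE KEYED N17 STUB** (no window hypothesis, any guard): the `βmTχ(θ)` rate at the reading's letters ON THE READING's OWN WINDOW
`(rr …).u3.γ ≤ θ.γ` for every tuple with provisos under the guard ⟹ the keyed N17 stub. [cite: Balaban1987RG1, (1.20)-(1.22) p.264] -/
theorem keyedN17₁₃_of_forall_merged
    (hin : ∀ (F : T4Family) (θ : Stage13Params F N) (hP : θ.Provisos₁₃ F N), P F θ hP → ∀ (g₀ : ℕ → ℝ) (os : List (ULoop F)),
      (rr F θ hP g₀ os).u3.γ ≤ θ.γ ∧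
        letI := θ.instVβ₁; letI := θ.instVβ₂; letI := θ.instιβ
        ScaleShiftRate ((rr F θ hP g₀ os).u3.cr * (rr F θ hP g₀ os).u3.C₅ * (rr F θ hP g₀ os).u3.θ) (rr F θ hP g₀ os).u3.ρ (rr F θ hP g₀ os).u3.γ
          (betaMerged F (mergedTermFamilyMatT F N (TcanOfRecord F N) (chiβOfRecord₁₃ F N θ) θ.εbg) θ.ρ8 θ.bV))
    (F : T4Family) (θ : Stage13Params F N) (hP : θ.Provisos₁₃ F N) (hθ : P F θ hP) (g₀ : ℕ → ℝ) (os : List (ULoop F)) :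
    N17At (datumOfRecord₁₃ F N θ hP) (rr F θ hP g₀ os).u3 := by
  obtain ⟨hγ, hm⟩ := hin F θ hP hθ g₀ os
  exact (n17At_datumOfRecord₁₃_iff_merged θ hP _ hγ).mpr hm

end KeyedGlue

/-- **THE SAME GLUE AT LAYER B's STAGE-13 TOWER KEY** `rc F h.params h.provisos g₀ os k` (the (T-RATE) `rateCarriersOfRecord₁₃ 𝔯`): the (D4) read-out and NE5 at the bundles of
every Stage-13 datum of record ⟹ N17 there; at the home this is `YMDAG.N17.s_N17_of_D4_N18` verbatim (record-generic, not restated). [cite: Balaban1987RG1, (1.20)-(1.22) p.264] -/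
theorem n17_towerKeyed₁₃_of_readOut
    (rc : (F : T4Family) → (θ : Stage13Params F N) → θ.Provisos₁₃ F N → (ℕ → ℝ) → List (ULoop F) → ℕ → RateCarriers N)
    (hD4 : ∀ (F : T4Family) (D : Datum F N) (h : IsDatumOfRecord₁₃C F N D) (g₀ : ℕ → ℝ) (os : List (ULoop F)) (k : ℕ),
      ReadOutAt D (rc F h.params h.provisos g₀ os k).u3)
    (h18 : ∀ (F : T4Family) (D : Datum F N) (h : IsDatumOfRecord₁₃C F N D) (g₀ : ℕ → ℝ) (os : List (ULoop F)) (k : ℕ),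
      N18At (rc F h.params h.provisos g₀ os k).u3)
    (F : T4Family) (D : Datum F N) (h : IsDatumOfRecord₁₃C F N D) (g₀ : ℕ → ℝ) (os : List (ULoop F)) (k : ℕ) :
    N17At D (rc F h.params h.provisos g₀ os k).u3 :=
  YMDAG.N17.n17At_of_readOutAt _ (hD4 F D h g₀ os k) (h18 F D h g₀ os k)

/-! ## §68 N17's ∀-FORM AT node00-def-RR-2's REGIME RECORD CLASSES `IsRecordOfRecord₁₃COn F N Rg` ∕ `IsRecordOfRecord₁₃CN F N` (the estimate asked only IN THE REGIME) -/

section RegimeRecords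

variable {Rg : (F : T4Family) → Stage13Params F N → Prop}

/-- **N17 AT A STAGE-13 RECORD `(D, w)` REALISED IN THE REGIME**: if at EVERY admissible Stage-13 tuple with provisos IN `Rg` realising `D` with `w.γ ≤ θ.γ` the merged β
`βmTχ(θ)` satisfies `ScaleShiftRate cN ρ w.γ`, then `NE4OnData D cN ρ w.γ` (companion 20's `N17_of_isRecordOfRecord₁₃C` with the regime available to the estimate; §65
`N17_iff_of_isRateKey₁₃`).  Hypothesis displayed, not asserted. [cite: Balaban1987RG1, (1.20)-(1.22) p.264; Balaban1989LargeFieldII, Thm 1 p.355] -/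
theorem N17_of_isRecordOfRecord₁₃COn {D : Datum F N} {w : WorldP} (h : IsRecordOfRecord₁₃COn F N Rg D w) {cN ρ : ℝ}
    (hin : ∀ (θ : Stage13Params F N) (hP : θ.Provisos₁₃ F N), Rg F θ → θ.Admissible F N → D = datumOfRecord₁₃ F N θ hP → w.γ ≤ θ.γ →
      letI := θ.instVβ₁; letI := θ.instVβ₂; letI := θ.instιβ
      ScaleShiftRate cN ρ w.γ (betaMerged F (mergedTermFamilyMatT F N (TcanOfRecord F N) (chiβOfRecord₁₃ F N θ) θ.εbg) θ.ρ8 θ.bV)) :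
    NE4OnData D cN ρ w.γ := by
  obtain ⟨θ, hRg, hk⟩ := h
  obtain ⟨hP, hθ, hD⟩ := hk.exists_provisos
  exact (N17_iff_of_isRateKey₁₃ hk cN ρ).mpr (hin θ hP hRg hθ hD hk.gamma_le)

/-- **… as an `iff`**: at a record realised in the regime, `NE4OnData D cN ρ w.γ` ⟺ the `βmTχ(θ)` rate on the world's window at EVERY admissible tuple with provisos in the regime
realising `D` with `w.γ ≤ θ.γ` (⇒: companion 20 `N17_datumOfRecord₁₃_iff_merged` at each such tuple). [bookkeeping] [cite: Balaban1987RG1, (1.20)-(1.22) p.264] -/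
theorem N17_iff_forall_of_isRecordOfRecord₁₃COn {D : Datum F N} {w : WorldP} (h : IsRecordOfRecord₁₃COn F N Rg D w) (cN ρ : ℝ) :
    NE4OnData D cN ρ w.γ ↔
      ∀ (θ : Stage13Params F N) (hP : θ.Provisos₁₃ F N), Rg F θ → θ.Admissible F N → D = datumOfRecord₁₃ F N θ hP → w.γ ≤ θ.γ →
        letI := θ.instVβ₁; letI := θ.instVβ₂; letI := θ.instιβ
        ScaleShiftRate cN ρ w.γ (betaMerged F (mergedTermFamilyMatT F N (TcanOfRecord F N) (chiβOfRecord₁₃ F N θ) θ.εbg) θ.ρ8 θ.bV) := by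
  refine ⟨fun hN θ hP _ _ hD hγ => ?_, N17_of_isRecordOfRecord₁₃COn h⟩
  subst hD
  exact (N17_datumOfRecord₁₃_iff_merged θ hP hγ).mp hN

/-- **N17 AT A RECORD OF RR-2's CN CLASS** (the guard of record `θ.ZtUnity F N ∧ θ.SlotsNondegenerate₁₃ F N`; `IsRecordOfRecord₁₃CN` = `IsRecordOfRecord₁₃COn … (unityNondeg₁₃ N)`):
the `βmTχ(θ)` rate asked only of the guarded admissible tuples with provisos realising `D`. [cite: Balaban1987RG1, (1.20)-(1.22) p.264; Balaban1988Convergent, (3.16)-(3.22) pp.268-269] -/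
theorem N17_of_isRecordOfRecord₁₃CN {D : Datum F N} {w : WorldP} (h : IsRecordOfRecord₁₃CN F N D w) {cN ρ : ℝ}
    (hin : ∀ (θ : Stage13Params F N) (hP : θ.Provisos₁₃ F N), θ.ZtUnity F N ∧ θ.SlotsNondegenerate₁₃ F N → θ.Admissible F N →
      D = datumOfRecord₁₃ F N θ hP → w.γ ≤ θ.γ →
      letI := θ.instVβ₁; letI := θ.instVβ₂; letI := θ.instιβ
      ScaleShiftRate cN ρ w.γ (betaMerged F (mergedTermFamilyMatT F N (TcanOfRecord F N) (chiβOfRecord₁₃ F N θ) θ.εbg) θ.ρ8 θ.bV)) :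
    NE4OnData D cN ρ w.γ :=
  N17_of_isRecordOfRecord₁₃COn h hin

/-- **(W2) CLOSER FOR AN `RRec` HOME KEYED TO THE REGIME RECORD CLASS**: if every bundle `R` of record for `(F, D, g₀, os)` comes with a world `w` making `(D, w)` a Stage-13 record
REALISED IN THE REGIME whose window IS node U3's box (`R.u3.γ = w.γ`), and the `βmTχ(θ)` rate at `R.u3`'s letters is supplied in the guarded ∀-form above, then `S_N17 RRec` —
companion 20's `s_N17_of_rec₁₃C` with the regime available to the estimate. [cite: Balaban1987RG1, (1.20)-(1.22) p.264] -/
theorem s_N17_of_rec₁₃COn (RRec : RateRecordPred N)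
    (hhome : ∀ (F : T4Family) (D : Datum F N) (g₀ : ℕ → ℝ) (os : List (ULoop F)) (R : RateCarriers N), RRec F D g₀ os R →
      ∃ w : WorldP, IsRecordOfRecord₁₃COn F N Rg D w ∧ R.u3.γ = w.γ)
    (hin : ∀ (F : T4Family) (D : Datum F N) (g₀ : ℕ → ℝ) (os : List (ULoop F)) (R : RateCarriers N), RRec F D g₀ os R →
      ∀ (θ : Stage13Params F N) (hP : θ.Provisos₁₃ F N), Rg F θ → θ.Admissible F N → D = datumOfRecord₁₃ F N θ hP → R.u3.γ ≤ θ.γ →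
        letI := θ.instVβ₁; letI := θ.instVβ₂; letI := θ.instιβ
        ScaleShiftRate (R.u3.cr * R.u3.C₅ * R.u3.θ) R.u3.ρ R.u3.γ
          (betaMerged F (mergedTermFamilyMatT F N (TcanOfRecord F N) (chiβOfRecord₁₃ F N θ) θ.εbg) θ.ρ8 θ.bV)) :
    S_N17 RRec := by
  intro F D g₀ os R hR
  obtain ⟨w, hw, hγ⟩ := hhome F D g₀ os R hR
  show NE4OnData D _ _ _
  rw [hγ]
  exact N17_of_isRecordOfRecord₁₃COn hw fun θ hP hRg hθ hD hle => hγ ▸ hin F D g₀ os R hR θ hP hRg hθ hD (hγ.le.trans hle)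

end RegimeRecords

end Summit.QuantumFields.YangMills.Theorems.BalabanUVNodesN17

end
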